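import Summits.QuantumFields.YangMills.Theorems.FemtoCurvatureTwoPoint.Negative.FiniteGroupSharedLink

/-!
# `FemtoCurvatureTwoPoint` is FALSE once `IsCompactSimpleLieGroup G` is weakened to `Nontrivial G`
# (CAPSTONE of the finite-group chain: `ConnectedSpace G` is load-bearing)

Negative lemma for crux `Summit.QuantumFields.YangMills.Theses.LangevinControlUV.
FemtoCurvatureTwoPoint` (item stmt-QuantumFields-9363; cdisprove gen 1 mechanism, gen 2 rates
`Negative.FiniteGroupSharedLink.eventually_rates` (p110484), gen 3 capstone).

* `cruxBody_false_of_finite` — for EVERY finite abelian non-trivial gauge group `G` (discrete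
  topology, any Borel structure) and every faithful unitary representation `ρ`, the BODY of the crux
  (`∃` unit map `a`, shape `Γ`, constants `β₀ ℓ₀ c C`, the two-sided axis clause and the all-pairs
  clause on every femto torus — verbatim, with `(r.N, r.ρ)` read as `(N, ρ)`) is FALSE.
  Mechanism: `a → 0` makes the torus `(ℤ/8)⁴` femto for all large `β` (`8 a(β) ≤ ℓ₀`); there the
  axis clause at `n = 1` reads `c · Γ(a(β)) ≤ Cov_β(P_0^{01}, P_{e₂}^{01}) ≤ C · Γ(a(β))` and the
  all-pairs clause at the distance-`1` pair `(x, y) = (0, e₂)`, planes `(0,2)` / `(0,1)` (the two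
  plaquettes SHARE the link `(e₂, 0)`) reads `|Cov_β(P_0^{02}, P_{e₂}^{01})| ≤ C · Γ(a(β))` — the
  SAME value of the shape function, so `c · |Cov_pair| ≤ C · Cov_axis`. With `ε = e^{-βδ}` (`δ` the
  action gap) the rates `Cov_axis ≤ M₁ ε⁸` and `Cov_pair ≥ δ² ε⁶ / 2 − M₂ ε⁸` (`eventually_rates`)
  force `c δ² / 2 ≤ (c M₂ + C M₁) ε²`, absurd as `β → ∞`.
* `femtoCurvatureTwoPoint_nontrivial_false` — the crux `FemtoCurvatureTwoPoint` with its hypothesis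
  `IsCompactSimpleLieGroup G` weakened to `Nontrivial G` (everything else verbatim, including
  `letI := borel G` and the datum `r : LatticeRep G`) is FALSE: witness `ℤ₂ = rootsOfUnityCircle 2`
  with its defining character `znRep 2` (continuous, faithful, unitary;
  `Literature.Barriers.QuantumFields.DiscreteSubgroupFreezing`).

So `ConnectedSpace G` (the first conjunct of `IsSimpleCompactGroup G` inside
`IsCompactSimpleLieGroup G`) is load-bearing for the crux: any proof must use that `G` is a Lie
group of positive dimension (then both covariances are `Θ(β⁻²)` on a fixed torus), not merely
compact and non-trivial. Companion: `Cruxes/FemtoCurvatureTwoPoint/Disproof.lean` § Resists item 3.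
-/

noncomputable section

open Filter Topology
open Literature.MathematicalPhysics.QuantumFieldTheory
open Literature.Barriers.QuantumFields
open Summit.QuantumFields.YangMills.Theorems.FemtoCurvatureTwoPoint.Negative.FiniteGroupSharedLink
  (eventually_rates)

namespace Summit.QuantumFields.YangMills.Theorems.FemtoCurvatureTwoPoint.Negative.FiniteGroupFalse

section Body

variable {G : Type} [CommGroup G] [Fintype G] [DecidableEq G] [TopologicalSpace G]
  [DiscreteTopology G] [IsTopologicalGroup G] [MeasurableSpace G] [BorelSpace G] {N : ℕ}
  (ρ : G →* Matrix (Fin N) (Fin N) ℂ)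

omit [DecidableEq G] in
/-- **The crux BODY fails for every finite abelian non-trivial gauge group with a faithful unitary
representation.** The negated statement is the body of `FemtoCurvatureTwoPoint` at the data
`(G, N, ρ)` — unit map, shape function, constants, the two-sided axis clause and the all-pairs clause
on every femto torus — verbatim (with `r.N ↦ N`, `r.ρ ↦ ρ`). -/
theorem cruxBody_false_of_finite [Nontrivial G] (hρu : ∀ g, ρ g ∈ Matrix.unitaryGroup (Fin N) ℂ)
    (hρinj : Function.Injective ρ) :
    ¬ ∃ (a : ℝ → ℝ), ∃ (Γ : ℝ → ℝ) (β₀ ℓ₀ c C : ℝ), 0 < ℓ₀ ∧ 0 < c ∧ (∀ β, 0 < a β) ∧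
        Filter.Tendsto a Filter.atTop (nhds 0) ∧ (∀ s : ℝ, 0 < s → s ≤ ℓ₀ → 0 < Γ s ∧ Γ s ≤ 1) ∧
        ∀ (L : ℕ) [NeZero L] (β : ℝ), β₀ ≤ β → (L : ℝ) * a β ≤ ℓ₀ →
          let P : (Fin 4 → ZMod L) → Fin 4 → Fin 4 → GaugeConfig 4 L G → ℝ :=
            fun x i j U => (N : ℝ) - (ρ (plaquetteHolonomy U x i j)).trace.re
          let E : (GaugeConfig 4 L G → ℝ) → ℝ := fun F => wilsonExpectation (d := 4) (L := L) ρ β F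
          let cov : (GaugeConfig 4 L G → ℝ) → (GaugeConfig 4 L G → ℝ) → ℝ :=
            fun F F' => E (fun U => F U * F' U) - E F * E F'
          let dist : (Fin 4 → ZMod L) → (Fin 4 → ZMod L) → ℝ :=
            fun x y => Real.sqrt (∑ k : Fin 4, (((x k - y k).valMinAbs : ℤ) : ℝ) ^ 2)
          (∀ n : ℕ, 1 ≤ n → 8 * n ≤ L →
              c * Γ ((n : ℝ) * a β) ≤
                  (n : ℝ) ^ 8 * cov (P 0 0 1) (P (Pi.single (2 : Fin 4) ((n : ℕ) : ZMod L)) 0 1) ∧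
                (n : ℝ) ^ 8 * cov (P 0 0 1) (P (Pi.single (2 : Fin 4) ((n : ℕ) : ZMod L)) 0 1) ≤
                  C * Γ ((n : ℝ) * a β)) ∧
            (∀ (x y : Fin 4 → ZMod L) (i j i' j' : Fin 4), x ≠ y → i ≠ j → i' ≠ j' →
              |cov (P x i j) (P y i' j')| * dist x y ^ 8 ≤ C * Γ (dist x y * a β)) := by
  classical
  rintro ⟨a, Γ, β₀, ℓ₀, c, C, hℓ, hc, ha, hat, hΓ, hcl⟩
  haveI : NeZero (8 : ℕ) := ⟨by norm_num⟩
  -- the two rates on `(ℤ/8)⁴`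
  obtain ⟨δ, M₁, M₂, hδ, hM₁, hM₂, hrates⟩ := eventually_rates ρ hρu hρinj
  -- `ε(β) = e^{-βδ} → 0`, hence `K ε² → 0` for the constant `K = c M₂ + |C| M₁`
  have hεt : Tendsto (fun β : ℝ => Real.exp (-(β * δ))) atTop (𝓝 0) := by
    have h1 : Tendsto (fun β : ℝ => -(β * δ)) atTop atBot :=
      tendsto_neg_atTop_atBot.comp (tendsto_id.atTop_mul_const hδ)
    exact Real.tendsto_exp_atBot.comp h1
  have hK2 : Tendsto (fun β : ℝ => (c * M₂ + |C| * M₁) * Real.exp (-(β * δ)) ^ 2) atTop (𝓝 0) := by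
    simpa using (hεt.pow 2).const_mul (c * M₂ + |C| * M₁)
  have hcδ : 0 < c * δ ^ 2 / 2 := by positivity
  have hevK : ∀ᶠ β : ℝ in atTop, (c * M₂ + |C| * M₁) * Real.exp (-(β * δ)) ^ 2 < c * δ ^ 2 / 2 :=
    hK2 (Iio_mem_nhds hcδ)
  -- the torus `L = 8` is femto for all large `β`
  have hfem : ∀ᶠ β : ℝ in atTop, a β < ℓ₀ / 8 := hat (Iio_mem_nhds (by positivity))
  obtain ⟨β, hβ₀, hrate, hKβ, haβ⟩ :=
    ((eventually_ge_atTop β₀).and (hrates.and (hevK.and hfem))).exists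
  have h8a : ((8 : ℕ) : ℝ) * a β ≤ ℓ₀ := by push_cast; linarith
  have hs : 0 < a β ∧ a β ≤ ℓ₀ := ⟨ha β, by linarith [ha β]⟩
  have hΓpos : 0 < Γ (a β) := (hΓ _ hs.1 hs.2).1
  -- abbreviations
  set ε : ℝ := Real.exp (-(β * δ)) with hε
  have hε0 : 0 < ε := Real.exp_pos _
  set CovAxis : ℝ :=
    wilsonExpectation (d := 4) (L := 8) ρ β (fun U =>
          ((N : ℝ) - (ρ (plaquetteHolonomy U (0 : Site 4 8) 0 1)).trace.re) *
            ((N : ℝ) - (ρ (plaquetteHolonomy U (Pi.single (2 : Fin 4) (((1 : ℕ) : ℕ) : ZMod 8))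
              0 1)).trace.re)) -
        wilsonExpectation (d := 4) (L := 8) ρ β
            (fun U => (N : ℝ) - (ρ (plaquetteHolonomy U (0 : Site 4 8) 0 1)).trace.re) *
          wilsonExpectation (d := 4) (L := 8) ρ β (fun U => (N : ℝ) -
            (ρ (plaquetteHolonomy U (Pi.single (2 : Fin 4) (((1 : ℕ) : ℕ) : ZMod 8)) 0 1)).trace.re)
    with hCovAxis
  set CovPair : ℝ :=
    wilsonExpectation (d := 4) (L := 8) ρ β (fun U =>
          ((N : ℝ) - (ρ (plaquetteHolonomy U (0 : Site 4 8) 0 2)).trace.re) *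
            ((N : ℝ) - (ρ (plaquetteHolonomy U (Pi.single (2 : Fin 4) (1 : ZMod 8)) 0 1)).trace.re)) -
        wilsonExpectation (d := 4) (L := 8) ρ β
            (fun U => (N : ℝ) - (ρ (plaquetteHolonomy U (0 : Site 4 8) 0 2)).trace.re) *
          wilsonExpectation (d := 4) (L := 8) ρ β (fun U => (N : ℝ) -
            (ρ (plaquetteHolonomy U (Pi.single (2 : Fin 4) (1 : ZMod 8)) 0 1)).trace.re)
    with hCovPair
  have hrate1 : CovAxis ≤ M₁ * ε ^ 8 := hrate.1
  have hrate2 : δ ^ 2 * ε ^ 6 / 2 - M₂ * ε ^ 8 ≤ CovPair := hrate.2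
  -- the axis clause at `L = 8`, `n = 1`
  have hax : c * Γ (((1 : ℕ) : ℝ) * a β) ≤ ((1 : ℕ) : ℝ) ^ 8 * CovAxis ∧
      ((1 : ℕ) : ℝ) ^ 8 * CovAxis ≤ C * Γ (((1 : ℕ) : ℝ) * a β) := by
    have := (hcl 8 β hβ₀ h8a).1 1 le_rfl (by norm_num)
    rw [hCovAxis]
    exact this
  simp only [Nat.cast_one, one_mul, one_pow] at hax
  -- the all-pairs clause at `L = 8`, `x = 0`, `y = e₂`, planes `(0,2)` and `(0,1)`
  have hxy : (0 : Fin 4 → ZMod 8) ≠ Pi.single (2 : Fin 4) (1 : ZMod 8) := by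
    intro h
    have h2 := congr_fun h 2
    simp only [Pi.zero_apply, Pi.single_eq_same] at h2
    exact absurd h2 (by decide)
  have hdist : Real.sqrt (∑ k : Fin 4,
      ((((0 : Fin 4 → ZMod 8) k - (Pi.single (2 : Fin 4) (1 : ZMod 8) : Fin 4 → ZMod 8) k).valMinAbs
        : ℤ) : ℝ) ^ 2) = 1 := by
    have hv : (-1 : ZMod 8).valMinAbs = -1 := by decide
    have hsum : (∑ k : Fin 4,
        ((((0 : Fin 4 → ZMod 8) k - (Pi.single (2 : Fin 4) (1 : ZMod 8) : Fin 4 → ZMod 8) k).valMinAbs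
          : ℤ) : ℝ) ^ 2) = 1 := by
      simp [Fin.sum_univ_four, Pi.single_apply, hv]
    rw [hsum, Real.sqrt_one]
  have hpair : |CovPair| ≤ C * Γ (a β) := by
    have h := (hcl 8 β hβ₀ h8a).2 0 (Pi.single (2 : Fin 4) (1 : ZMod 8)) 0 2 0 1 hxy
      (by decide) (by decide)
    dsimp only at h
    rw [hdist, one_pow, mul_one, one_mul] at h
    rw [hCovPair]
    exact h
  -- real arithmetic
  clear_value CovAxis CovPair ε
  have hcC : c ≤ C := by
    have h1 : c * Γ (a β) ≤ C * Γ (a β) := hax.1.trans hax.2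
    exact le_of_mul_le_mul_right h1 hΓpos
  have hC0 : 0 ≤ C := hc.le.trans hcC
  have hCabs : |C| = C := abs_of_nonneg hC0
  rw [hCabs] at hKβ
  -- `c (δ²ε⁶/2 − M₂ε⁸) ≤ c |CovPair| ≤ c C Γ ≤ C CovAxis ≤ C M₁ ε⁸`
  have h1 : δ ^ 2 * ε ^ 6 / 2 - M₂ * ε ^ 8 ≤ |CovPair| := hrate2.trans (le_abs_self _)
  have h2 : c * (δ ^ 2 * ε ^ 6 / 2 - M₂ * ε ^ 8) ≤ c * (C * Γ (a β)) :=
    mul_le_mul_of_nonneg_left (h1.trans hpair) hc.le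
  have h3 : C * (c * Γ (a β)) ≤ C * (M₁ * ε ^ 8) :=
    mul_le_mul_of_nonneg_left (hax.1.trans hrate1) hC0
  have h4 : c * (δ ^ 2 * ε ^ 6 / 2) ≤ (c * M₂ + C * M₁) * ε ^ 6 * ε ^ 2 := by nlinarith [h2, h3]
  have hε6 : 0 < ε ^ 6 := pow_pos hε0 6
  have h5 : c * δ ^ 2 / 2 ≤ (c * M₂ + C * M₁) * ε ^ 2 := by
    have : (c * δ ^ 2 / 2) * ε ^ 6 ≤ ((c * M₂ + C * M₁) * ε ^ 2) * ε ^ 6 := by nlinarith [h4]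
    exact le_of_mul_le_mul_right this hε6
  linarith [h5, hKβ]

end Body

/-- **`FemtoCurvatureTwoPoint` with `IsCompactSimpleLieGroup G` weakened to `Nontrivial G` is
FALSE** (everything else verbatim, including the Borel structure `letI := borel G` and the datum
`r : LatticeRep G`). Witness: `ℤ₂ = rootsOfUnityCircle 2` with its defining character `znRep 2`.
Hence `ConnectedSpace G` (inside `IsSimpleCompactGroup G`, the first conjunct of
`IsCompactSimpleLieGroup G`) is a load-bearing hypothesis of the crux. -/
theorem femtoCurvatureTwoPoint_nontrivial_false :
    ¬ (∀ (G : Type) [Group G] [TopologicalSpace G] [IsTopologicalGroup G] [CompactSpace G],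
        Nontrivial G →
          letI : MeasurableSpace G := borel G
          haveI : BorelSpace G := ⟨rfl⟩
          ∀ (r : LatticeRep G), ∃ (a : ℝ → ℝ), ∃ (Γ : ℝ → ℝ) (β₀ ℓ₀ c C : ℝ), 0 < ℓ₀ ∧ 0 < c ∧
            (∀ β, 0 < a β) ∧ Filter.Tendsto a Filter.atTop (nhds 0) ∧
            (∀ s : ℝ, 0 < s → s ≤ ℓ₀ → 0 < Γ s ∧ Γ s ≤ 1) ∧
            ∀ (L : ℕ) [NeZero L] (β : ℝ), β₀ ≤ β → (L : ℝ) * a β ≤ ℓ₀ →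
              let P : (Fin 4 → ZMod L) → Fin 4 → Fin 4 → GaugeConfig 4 L G → ℝ :=
                fun x i j U => (r.N : ℝ) - (r.ρ (plaquetteHolonomy U x i j)).trace.re
              let E : (GaugeConfig 4 L G → ℝ) → ℝ := fun F =>
                wilsonExpectation (d := 4) (L := L) r.ρ β F
              let cov : (GaugeConfig 4 L G → ℝ) → (GaugeConfig 4 L G → ℝ) → ℝ := fun F F' =>
                E (fun U => F U * F' U) - E F * E F'
              let dist : (Fin 4 → ZMod L) → (Fin 4 → ZMod L) → ℝ := fun x y =>
                Real.sqrt (∑ k : Fin 4, (((x k - y k).valMinAbs : ℤ) : ℝ) ^ 2)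
              (∀ n : ℕ, 1 ≤ n → 8 * n ≤ L →
                  c * Γ ((n : ℝ) * a β) ≤
                      (n : ℝ) ^ 8 * cov (P 0 0 1) (P (Pi.single (2 : Fin 4) ((n : ℕ) : ZMod L)) 0 1) ∧
                    (n : ℝ) ^ 8 * cov (P 0 0 1) (P (Pi.single (2 : Fin 4) ((n : ℕ) : ZMod L)) 0 1) ≤
                      C * Γ ((n : ℝ) * a β)) ∧
                (∀ (x y : Fin 4 → ZMod L) (i j i' j' : Fin 4), x ≠ y → i ≠ j → i' ≠ j' →
                  |cov (P x i j) (P y i' j')| * dist x y ^ 8 ≤ C * Γ (dist x y * a β))) := by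
  intro h
  classical
  haveI : Fact (2 ≤ 2) := ⟨le_rfl⟩
  haveI : Fintype (rootsOfUnityCircle 2) := Fintype.ofFinite _
  letI : MeasurableSpace (rootsOfUnityCircle 2) := borel _
  haveI : BorelSpace (rootsOfUnityCircle 2) := ⟨rfl⟩
  let r : LatticeRep (rootsOfUnityCircle 2) :=
    ⟨1, znRep 2, continuous_znRep 2, znRep_injective 2, znRep_mem_unitaryGroup 2⟩
  have hr := h (rootsOfUnityCircle 2) inferInstance r
  exact cruxBody_false_of_finite (G := rootsOfUnityCircle 2) (N := 1) (znRep 2)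
    (znRep_mem_unitaryGroup 2) (znRep_injective 2) hr

end Summit.QuantumFields.YangMills.Theorems.FemtoCurvatureTwoPoint.Negative.FiniteGroupFalse

end
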